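import Literature.RepresentationTheory.Semisimple.SubrepresentationEquiv
import Literature.RepresentationTheory.Semisimple.Twist
import Mathlib.LinearAlgebra.Dimension.Constructions
import Mathlib.Algebra.BigOperators.Fin
import HarnessLib

/-!
# Multiplicities of irreducible constituents: `[ρ : U] = dim_k Hom_G(U, ρ)`

Topic `Literature/RepresentationTheory/Semisimple`.  For representations over a field `k`, the
**multiplicity** of `U` in `ρ` is `Representation.mult U ρ := dim_k Hom_G(U, ρ)` (Mathlib
`Representation.IntertwiningMap`, a `k`-module); for `U` irreducible, `k` algebraically closed
and `ρ` finite-dimensional semisimple this is the number of summands equivalent to `U` in any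
decomposition of `ρ` into irreducibles (Schur's lemma; Curtis–Reiner, *Methods of Representation
Theory* I, (3.17)–(3.20); Serre, *Linear Representations of Finite Groups*, § 2.3 for finite
groups).  Mathlib (this pin) has Schur's lemma in the forms
`Representation.IsIrreducible.finrank_intertwiningMap_self` (`End_G(U) = k`) and the
`Subsingleton` instance for `Hom_G` between non-equivalent irreducibles, but no multiplicity
calculus; this file provides it (all proved):

* functoriality: `mult_prod` (`[ρ ⊕ σ : U] = [ρ : U] + [σ : U]`), `mult_pi` (finite direct
  sums, with the direct sum `Representation.pi` of a family and `IntertwiningMap.piLinearEquiv`),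
  `mult_congr_left/right` (invariance under equivalence), `mult_twist`, `mult_twist_right`
  (twisting by a character, file `Twist`);
* `Representation.pi`, `twist_pi`, `twist_prod`, and semisimplicity of finite and binary direct
  sums of semisimple representations (through the `k[G]`-module dictionary,
  `Representation.piAsModuleEquiv`, `prodAsModuleEquiv`);
* vanishing and positivity (`mult_eq_zero_of_subsingleton`, `mult_pos_iff`,
  `Subrepresentation.mult_toRepresentation_pos`), `Representation.nontrivial_of_isIrreducible`;
* Schur: `mult_self = 1`, `mult_eq_one_of_equiv`, `mult_eq_zero_of_isEmpty_equiv`, `mult_eq_ite`.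

The counting of multiplicities in a decomposition and Krull–Schmidt are in the sequel
`MultiplicityDecomposition`.  Declarations live in `namespace
Literature.RepresentationTheory.Semisimple`, named after the Mathlib structures they concern.
-/

noncomputable section

namespace Literature.RepresentationTheory.Semisimple

open scoped MonoidAlgebra
open Literature.RepresentationTheory.FiniteGroups

universe u v w₀ w w'

variable {k : Type u} [Field k] {G : Type v} [Group G]
  {X : Type w₀} [AddCommGroup X] [Module k X]
  {V : Type w} [AddCommGroup V] [Module k V] {W : Type w'} [AddCommGroup W] [Module k W]

/-- The **multiplicity** `[ρ : U] := dim_k Hom_G(U, ρ)` of a representation `U` (think: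
irreducible) in a representation `ρ`. [folklore] -/
def Representation.mult (U : Representation k G X) (ρ : Representation k G V) : ℕ :=
  Module.finrank k (Representation.IntertwiningMap U ρ)

/-! ### Functoriality -/

/-- `Hom_G(U, ρ ⊕ σ) ≃ Hom_G(U, ρ) × Hom_G(U, σ)`. [folklore] -/
def Representation.IntertwiningMap.prodLinearEquiv (U : Representation k G X)
    (ρ : Representation k G V) (σ : Representation k G W) :
    Representation.IntertwiningMap U (ρ.prod σ) ≃ₗ[k]
      Representation.IntertwiningMap U ρ × Representation.IntertwiningMap U σ where
  toFun f := ((Representation.IntertwiningMap.fst k ρ σ).comp f,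
    (Representation.IntertwiningMap.snd k ρ σ).comp f)
  invFun p := Representation.IntertwiningMap.prod p.1 p.2
  left_inv _ := Representation.IntertwiningMap.ext (LinearMap.ext fun _ => rfl)
  right_inv _ := Prod.ext (Representation.IntertwiningMap.ext (LinearMap.ext fun _ => rfl))
    (Representation.IntertwiningMap.ext (LinearMap.ext fun _ => rfl))
  map_add' _ _ := rfl
  map_smul' _ _ := rfl

/-- **Additivity**: `[ρ ⊕ σ : U] = [ρ : U] + [σ : U]`. [folklore] -/
theorem Representation.mult_prod [FiniteDimensional k X] [FiniteDimensional k V]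
    [FiniteDimensional k W] (U : Representation k G X) (ρ : Representation k G V)
    (σ : Representation k G W) :
    Representation.mult U (ρ.prod σ) = Representation.mult U ρ + Representation.mult U σ := by
  rw [Representation.mult, (Representation.IntertwiningMap.prodLinearEquiv U ρ σ).finrank_eq,
    Module.finrank_prod]
  rfl

/-- `Hom_G(U, ρ) ≃ Hom_G(U, σ)` for `ρ ≃ σ` (post-composition). [folklore] -/
def Representation.IntertwiningMap.congrRight (U : Representation k G X)
    {ρ : Representation k G V} {σ : Representation k G W} (e : Representation.Equiv ρ σ) :
    Representation.IntertwiningMap U ρ ≃ₗ[k] Representation.IntertwiningMap U σ where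
  toFun f := e.toIntertwiningMap.comp f
  invFun f := e.symm.toIntertwiningMap.comp f
  left_inv f := Representation.IntertwiningMap.ext (LinearMap.ext fun v => e.symm_apply_apply (f v))
  right_inv f := Representation.IntertwiningMap.ext (LinearMap.ext fun v => e.apply_symm_apply (f v))
  map_add' f f' := Representation.IntertwiningMap.ext (LinearMap.ext fun v => by
    change e.toIntertwiningMap ((f + f') v) = e.toIntertwiningMap (f v) + e.toIntertwiningMap (f' v)
    rw [← map_add]; rfl)
  map_smul' c f := Representation.IntertwiningMap.ext (LinearMap.ext fun v => by
    change e.toIntertwiningMap ((c • f) v) = c • e.toIntertwiningMap (f v)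
    rw [Representation.IntertwiningMap.smul_apply, map_smul])

/-- `Hom_G(U, ρ) ≃ Hom_G(U', ρ)` for `U ≃ U'` (pre-composition). [folklore] -/
def Representation.IntertwiningMap.congrLeft {X' : Type*} [AddCommGroup X'] [Module k X']
    {U : Representation k G X} {U' : Representation k G X'} (e : Representation.Equiv U U')
    (ρ : Representation k G V) :
    Representation.IntertwiningMap U ρ ≃ₗ[k] Representation.IntertwiningMap U' ρ where
  toFun f := f.comp e.symm.toIntertwiningMap
  invFun f := f.comp e.toIntertwiningMap
  left_inv f := Representation.IntertwiningMap.ext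
    (LinearMap.ext fun v => congrArg f (e.symm_apply_apply v))
  right_inv f := Representation.IntertwiningMap.ext
    (LinearMap.ext fun v => congrArg f (e.apply_symm_apply v))
  map_add' _ _ := rfl
  map_smul' _ _ := rfl

/-- `[ρ : U]` only depends on `ρ` up to equivalence. [folklore] -/
theorem Representation.mult_congr_right (U : Representation k G X) {ρ : Representation k G V}
    {σ : Representation k G W} (e : Representation.Equiv ρ σ) :
    Representation.mult U ρ = Representation.mult U σ :=
  (Representation.IntertwiningMap.congrRight U e).finrank_eq

/-- `[ρ : U]` only depends on `U` up to equivalence. [folklore] -/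
theorem Representation.mult_congr_left {X' : Type*} [AddCommGroup X'] [Module k X']
    {U : Representation k G X} {U' : Representation k G X'} (e : Representation.Equiv U U')
    (ρ : Representation k G V) : Representation.mult U ρ = Representation.mult U' ρ :=
  (Representation.IntertwiningMap.congrLeft e ρ).finrank_eq

/-- **Twist invariance**: `[ρ ⊗ χ : U ⊗ χ] = [ρ : U]`. [folklore] -/
theorem Representation.mult_twist (U : Representation k G X) (ρ : Representation k G V)
    (χ : G →* kˣ) :
    Representation.mult (Representation.twist U χ) (Representation.twist ρ χ) =
      Representation.mult U ρ :=
  (Representation.IntertwiningMap.twistLinearEquiv U ρ χ).finrank_eq.symm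

/-- `[ρ ⊗ χ : U] = [ρ : U ⊗ χ⁻¹]`. [folklore] -/
theorem Representation.mult_twist_right (U : Representation k G X) (ρ : Representation k G V)
    (χ : G →* kˣ) :
    Representation.mult U (Representation.twist ρ χ) =
      Representation.mult (Representation.twist U χ⁻¹) ρ := by
  conv_lhs => rw [← Representation.twist_inv_twist U χ]
  exact Representation.mult_twist _ _ _


/-! ### Finite direct sums -/

section Pi

variable {ι : Type*} {C : ι → Type w} [∀ j, AddCommGroup (C j)] [∀ j, Module k (C j)]

/-- The **direct sum** (product) `⊕_j τ_j` of a family of representations, on `Π j, C j`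
(componentwise action; for finite index types this is Mathlib's `Representation.directSum` up to
`DirectSum ≃ Π`). [folklore] -/
def Representation.pi (τ : ∀ j, Representation k G (C j)) : Representation k G (∀ j, C j) where
  toFun g := LinearMap.pi fun j => (τ j g).comp (LinearMap.proj j)
  map_one' := by ext v j; simp
  map_mul' g h := by ext v j; simp

/-- Unfolding lemma for `Representation.pi`. [folklore] -/
@[simp] theorem Representation.pi_apply_apply (τ : ∀ j, Representation k G (C j)) (g : G)
    (v : ∀ j, C j) (j : ι) : Representation.pi τ g v j = τ j g (v j) := rfl

/-- `Hom_G(U, ⊕_j τ_j) ≃ Π_j Hom_G(U, τ_j)`. [folklore] -/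
def Representation.IntertwiningMap.piLinearEquiv (U : Representation k G X)
    (τ : ∀ j, Representation k G (C j)) :
    Representation.IntertwiningMap U (Representation.pi τ) ≃ₗ[k]
      ∀ j, Representation.IntertwiningMap U (τ j) where
  toFun f j := ⟨(LinearMap.proj j).comp f.toLinearMap, fun g => LinearMap.ext fun v =>
    congrFun (congr($(f.isIntertwining' g) v) :) j⟩
  invFun F := ⟨LinearMap.pi fun j => (F j).toLinearMap, fun g => LinearMap.ext fun v =>
    funext fun j => congr($((F j).isIntertwining' g) v)⟩
  left_inv _ := Representation.IntertwiningMap.ext (LinearMap.ext fun _ => rfl)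
  right_inv _ := funext fun _ => Representation.IntertwiningMap.ext (LinearMap.ext fun _ => rfl)
  map_add' _ _ := rfl
  map_smul' _ _ := rfl

/-- **Additivity over finite direct sums**: `[⊕_j τ_j : U] = ∑_j [τ_j : U]`. [folklore] -/
theorem Representation.mult_pi [Fintype ι] [FiniteDimensional k X] [∀ j, FiniteDimensional k (C j)]
    (U : Representation k G X) (τ : ∀ j, Representation k G (C j)) :
    Representation.mult U (Representation.pi τ) = ∑ j, Representation.mult U (τ j) := by
  rw [Representation.mult, (Representation.IntertwiningMap.piLinearEquiv U τ).finrank_eq,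
    Module.finrank_pi_fintype]
  rfl

/-- Twisting commutes with direct sums. [folklore] -/
theorem Representation.twist_pi (τ : ∀ j, Representation k G (C j)) (χ : G →* kˣ) :
    Representation.twist (Representation.pi τ) χ =
      Representation.pi fun j => Representation.twist (τ j) χ := by
  ext g v j
  simp

/-- The `k[G]`-module of a direct sum of representations is the product of the `k[G]`-modules
(identity on vectors). [folklore] -/
def Representation.piAsModuleEquiv (τ : ∀ j, Representation k G (C j)) :
    (Representation.pi τ).asModule ≃ₗ[k[G]] ∀ j, (τ j).asModule where
  toFun v j := (τ j).asModuleEquiv.symm ((Representation.pi τ).asModuleEquiv v j)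
  invFun v := (Representation.pi τ).asModuleEquiv.symm fun j => (τ j).asModuleEquiv (v j)
  left_inv _ := rfl
  right_inv _ := rfl
  map_add' _ _ := rfl
  map_smul' r v := by
    funext j
    change (Representation.pi τ).asAlgebraHom r ((Representation.pi τ).asModuleEquiv v) j =
      (τ j).asAlgebraHom r ((Representation.pi τ).asModuleEquiv v j)
    induction r using MonoidAlgebra.induction_on with
    | hM g => rw [Representation.asAlgebraHom_of, Representation.asAlgebraHom_of]; rfl
    | hadd x y hx hy => simp only [map_add, LinearMap.add_apply, Pi.add_apply, hx, hy]
    | hsmul c x hx => simp only [map_smul, LinearMap.smul_apply, Pi.smul_apply, hx]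

/-- A finite direct sum of semisimple representations is semisimple. [folklore] -/
instance Representation.isSemisimpleRepresentation_pi [Finite ι]
    (τ : ∀ j, Representation k G (C j)) [∀ j, (τ j).IsSemisimpleRepresentation] :
    (Representation.pi τ).IsSemisimpleRepresentation := by
  haveI : ∀ j, IsSemisimpleModule k[G] (τ j).asModule := fun j =>
    (Representation.isSemisimpleRepresentation_iff_isSemisimpleModule_asModule _).mp inferInstance
  rw [Representation.isSemisimpleRepresentation_iff_isSemisimpleModule_asModule]
  exact IsSemisimpleModule.congr (Representation.piAsModuleEquiv τ)

end Pi

/-! ### Binary direct sums -/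

/-- Twisting commutes with binary direct sums. [folklore] -/
theorem Representation.twist_prod (ρ : Representation k G V) (σ : Representation k G W)
    (χ : G →* kˣ) :
    Representation.twist (ρ.prod σ) χ =
      (Representation.twist ρ χ).prod (Representation.twist σ χ) := by
  ext g v <;> simp

/-- The `k[G]`-module of `ρ ⊕ σ` is the product of the `k[G]`-modules (identity on vectors).
[folklore] -/
def Representation.prodAsModuleEquiv (ρ : Representation k G V) (σ : Representation k G W) :
    (ρ.prod σ).asModule ≃ₗ[k[G]] ρ.asModule × σ.asModule where
  toFun v := (ρ.asModuleEquiv.symm ((ρ.prod σ).asModuleEquiv v).1,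
    σ.asModuleEquiv.symm ((ρ.prod σ).asModuleEquiv v).2)
  invFun v := (ρ.prod σ).asModuleEquiv.symm (ρ.asModuleEquiv v.1, σ.asModuleEquiv v.2)
  left_inv _ := rfl
  right_inv _ := rfl
  map_add' _ _ := rfl
  map_smul' r v := by
    change (((ρ.prod σ).asAlgebraHom r ((ρ.prod σ).asModuleEquiv v)).1,
        ((ρ.prod σ).asAlgebraHom r ((ρ.prod σ).asModuleEquiv v)).2) =
      (ρ.asAlgebraHom r ((ρ.prod σ).asModuleEquiv v).1,
        σ.asAlgebraHom r ((ρ.prod σ).asModuleEquiv v).2)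
    induction r using MonoidAlgebra.induction_on with
    | hM g => rw [Representation.asAlgebraHom_of, Representation.asAlgebraHom_of,
        Representation.asAlgebraHom_of]; rfl
    | hadd x y hx hy =>
      simp only [map_add, LinearMap.add_apply, Prod.fst_add, Prod.snd_add, Prod.mk.injEq] at hx hy ⊢
      rw [hx.1, hx.2, hy.1, hy.2]
      exact ⟨rfl, rfl⟩
    | hsmul c x hx =>
      simp only [map_smul, LinearMap.smul_apply, Prod.smul_fst, Prod.smul_snd, Prod.mk.injEq]
        at hx ⊢
      rw [hx.1, hx.2]
      exact ⟨rfl, rfl⟩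

/-- A binary direct sum of semisimple representations is semisimple (Mathlib has the `Π`
instance for modules only; the binary product of semisimple modules is semisimple as the sup of
the two semisimple ranges). [folklore] -/
instance Representation.isSemisimpleRepresentation_prod (ρ : Representation k G V)
    (σ : Representation k G W) [ρ.IsSemisimpleRepresentation] [σ.IsSemisimpleRepresentation] :
    (ρ.prod σ).IsSemisimpleRepresentation := by
  haveI : IsSemisimpleModule k[G] ρ.asModule :=
    (Representation.isSemisimpleRepresentation_iff_isSemisimpleModule_asModule _).mp inferInstance
  haveI : IsSemisimpleModule k[G] σ.asModule :=
    (Representation.isSemisimpleRepresentation_iff_isSemisimpleModule_asModule _).mp inferInstance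
  haveI : IsSemisimpleModule k[G] (ρ.asModule × σ.asModule) := by
    have h1 : IsSemisimpleModule k[G] (LinearMap.range (LinearMap.inl k[G] ρ.asModule σ.asModule)) :=
      .of_surjective _ (LinearMap.inl k[G] _ _).surjective_rangeRestrict
    have h2 : IsSemisimpleModule k[G] (LinearMap.range (LinearMap.inr k[G] ρ.asModule σ.asModule)) :=
      .of_surjective _ (LinearMap.inr k[G] _ _).surjective_rangeRestrict
    have h := IsSemisimpleModule.sup h1 h2
    rw [LinearMap.sup_range_inl_inr] at h
    exact .congr (Submodule.topEquiv).symm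
  rw [Representation.isSemisimpleRepresentation_iff_isSemisimpleModule_asModule]
  exact IsSemisimpleModule.congr (Representation.prodAsModuleEquiv ρ σ)

/-- Equal representations (on the same space) are equivalent; used to rewrite inside `Equiv`.
[folklore] -/
def Representation.Equiv.ofEq {ρ σ : Representation k G V} (h : ρ = σ) : Representation.Equiv ρ σ :=
  Representation.Equiv.mk (LinearEquiv.refl k V) fun g => by subst h; rfl

/-! ### Vanishing, positivity, Schur -/

/-- Nothing maps to the zero representation: `[0 : U] = 0`. [folklore] -/
theorem Representation.mult_eq_zero_of_subsingleton [Subsingleton V] (U : Representation k G X)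
    (ρ : Representation k G V) : Representation.mult U ρ = 0 := by
  haveI : Subsingleton (Representation.IntertwiningMap U ρ) :=
    ⟨fun f g => Representation.IntertwiningMap.ext (LinearMap.ext fun _ => Subsingleton.elim _ _)⟩
  exact Module.finrank_zero_of_subsingleton

/-- `[ρ : U] > 0` iff there is a non-zero intertwining map `U → ρ`. [folklore] -/
theorem Representation.mult_pos_iff [FiniteDimensional k X] [FiniteDimensional k V]
    (U : Representation k G X) (ρ : Representation k G V) :
    0 < Representation.mult U ρ ↔ ∃ f : Representation.IntertwiningMap U ρ, f ≠ 0 :=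
  Module.finrank_pos_iff_exists_ne_zero

/-- A non-zero subrepresentation occurs with positive multiplicity. [folklore] -/
theorem Subrepresentation.mult_toRepresentation_pos [FiniteDimensional k V]
    {ρ : Representation k G V} (S : Subrepresentation ρ) [Nontrivial S.toSubmodule] :
    0 < Representation.mult S.toRepresentation ρ := by
  rw [Representation.mult_pos_iff]
  refine ⟨Subrepresentation.subtypeIntertwiningMap S, fun h => ?_⟩
  obtain ⟨x, hx⟩ := exists_ne (0 : S.toSubmodule)
  apply hx
  apply Subrepresentation.subtypeIntertwiningMap_injective S
  rw [h, map_zero]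
  rfl

/-- An irreducible representation lives on a non-zero space.  (The tree has the same
statement as `Representation.IsIrreducible.nontrivial` in
`Literature/NumberTheory/Automorphic/RestrictedTensorProductIrreducibleProofs`, behind the
restricted-tensor-product imports of the Automorphic layer; it is restated here rather than
imported so as not to invert the layering — librarian: redirect that copy here.) [folklore] -/
theorem Representation.nontrivial_of_isIrreducible (ρ : Representation k G V) [ρ.IsIrreducible] :
    Nontrivial V := by
  by_contra h
  rw [not_nontrivial_iff_subsingleton] at h
  have : (⊥ : Subrepresentation ρ) = ⊤ :=
    Subrepresentation.toSubmodule_injective (Subsingleton.elim _ _)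
  exact (IsSimpleOrder.bot_ne_top (α := Subrepresentation ρ)) this

section Schur

variable [IsAlgClosed k] [FiniteDimensional k X]

/-- **Schur**: an irreducible occurs in itself with multiplicity one (`End_G(U) = k`, Mathlib
`Representation.IsIrreducible.finrank_intertwiningMap_self`). [folklore] -/
theorem Representation.mult_self (U : Representation k G X) [U.IsIrreducible] :
    Representation.mult U U = 1 :=
  Representation.IsIrreducible.finrank_intertwiningMap_self U

/-- **Schur**: `[S : U] = 1` for equivalent irreducibles `U ≃ S`. [folklore] -/
theorem Representation.mult_eq_one_of_equiv {U : Representation k G X} [U.IsIrreducible]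
    {S : Representation k G V} (e : Representation.Equiv U S) : Representation.mult U S = 1 := by
  rw [← Representation.mult_congr_right U e, Representation.mult_self]

omit [IsAlgClosed k] [FiniteDimensional k X] in
/-- **Schur**: `[S : U] = 0` for non-equivalent irreducibles. [folklore] -/
theorem Representation.mult_eq_zero_of_isEmpty_equiv {U : Representation k G X} [U.IsIrreducible]
    {S : Representation k G V} [S.IsIrreducible] (h : IsEmpty (Representation.Equiv U S)) :
    Representation.mult U S = 0 := by
  haveI := h
  exact Module.finrank_zero_of_subsingleton

open Classical in
/-- **Schur**, combined: for irreducibles, `[S : U] = 1` if `U ≃ S` and `0` otherwise.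
[folklore] -/
theorem Representation.mult_eq_ite {U : Representation k G X} [U.IsIrreducible]
    {S : Representation k G V} [S.IsIrreducible] :
    Representation.mult U S = if Nonempty (Representation.Equiv U S) then 1 else 0 := by
  split_ifs with h
  · exact Representation.mult_eq_one_of_equiv h.some
  · exact Representation.mult_eq_zero_of_isEmpty_equiv (not_nonempty_iff.mp h)

end Schur

end Literature.RepresentationTheory.Semisimple
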